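import Literature.Geometry.Lorentzian.CoordDivergenceIntegral
import Literature.Geometry.Lorentzian.CoordScalarCurvatureAdjoint
import Literature.Geometry.Lorentzian.CoordEntropyFormula
import HarnessLib

/-!
# Weighted Poincaré inequalities in coordinates (Chruściel–Delay 2003, App. C, Lemma C.1, Prop. C.2)

Topic `Literature/Geometry/Lorentzian`, coordinate tensor calculus `MetricCoord` (Riemannian metric
components `G` on an open set `V` of a finite-dimensional space, `IsMetricOn G V` and positivity).
Everything here is PROVED; no definition and no statement of `Prop` type is introduced.

The first brick of the weighted elliptic theory of Chruściel–Delay (Mém. SMF 94 (2003)) behind the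
compact-annulus hypothesis `(E)` of `ChruscielDelay_parametricAnnulusGluing_of_compactCore`
(`ParametricAnnulusGluingKIDRigidity.lean`): the **weighted Poincaré inequalities** of Appendix C,
here for scalar functions.

* `IsMetricOn.weightedPoincare_pointwise` — the pointwise Green identity behind Prop. C.2: for
  `u, v, w` smooth on `V` and `x ∈ V`,
  `e^{2v} |∇u|² − e^{2v} (Δv + Δw + |∇v|² − |∇w|²) u² = e^{2v} |du + u d(v+w)|²_G + div_G B`,
  `B = −u² e^{2v} ∇(v + w)`;
* **`IsMetricOn.integral_weightedPoincare`** — **Prop. C.2**: for `u` smooth on `V` with compact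
  support inside `V` and `v, w` smooth on `V`,
  `∫ √det g · e^{2v} (Δv + Δw + |∇v|² − |∇w|²) u² dμ ≤ ∫ √det g · e^{2v} |∇u|² dμ`
  (the divergence integrates to zero by the coordinate divergence theorem
  `IsMetricOn.integral_sqrtDetGram_mul_divAt_eq_zero`, and `|du + u d(v+w)|²_G ≥ 0`);
* `IsMetricOn.integral_poincare_lemmaC1` — **Lemma C.1** (`v = 0`):
  `∫ √det g · (Δw − |∇w|²) u² dμ ≤ ∫ √det g · |∇u|² dμ`.

With `v = −s/x + t log x`, `w = 0` for a boundary defining function `x` these give the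
exponentially weighted inequality (C.6) of Prop. C.4, the scalar half of the coercivity estimate
(3.4) near the boundary (Cor. D.5, Thm. 5.6) on which Thm. 5.9 rests.

## References

* P. T. Chruściel, E. Delay, *On mapping properties of the general relativistic constraints
  operator in weighted function spaces*, Mém. Soc. Math. Fr. 94 (2003), App. C, Lemma C.1,
  Prop. C.2, Prop. C.4. [ChruscielDelay2003]
* B. O'Neill, *Semi-Riemannian geometry*, 1983, Ch. 7, Lemma 7.21 (divergence theorem).
  [ONeill1983]
-/

noncomputable section

set_option maxSynthPendingDepth 3

open Set Filter Module Function MeasureTheory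
open scoped Topology ContDiff

namespace Literature.Geometry.Lorentzian

namespace MetricCoord

variable {E : Type*} [NormedAddCommGroup E] [NormedSpace ℝ E] [FiniteDimensional ℝ E]
  [CompleteSpace E] {ι : Type*} [Fintype ι] [DecidableEq ι] (b : Basis ι ℝ E)
  {G : E → E →L[ℝ] E →L[ℝ] ℝ} {V : Set E} {x : E} {u v w : E → ℝ}

/-! ### Algebra of `♯` -/

omit [FiniteDimensional ℝ E] [CompleteSpace E] in
/-- For symmetric invertible `G x`: `α(♯β) = β(♯α)` (local copy of the lemma of
`CoordFisherDissipation.lean`, to keep the import cone small). [folklore] -/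
private theorem apply_sharpAt_comm' (hx : (G x).IsInvertible) (hs : ∀ v w : E, G x v w = G x w v)
    (α β : E →L[ℝ] ℝ) : α (sharpAt G x β) = β (sharpAt G x α) := by
  rw [← apply_sharpAt_apply hx α (sharpAt G x β), hs, apply_sharpAt_apply hx]

/-! ### The pointwise identity -/

/-- **The Green identity behind Prop. C.2** (Chruściel–Delay 2003, proof of Prop. C.2): for
`u, v, w` smooth on `V` and `x ∈ V`,
`e^{2v}|∇u|² − e^{2v}(Δv + Δw + |∇v|² − |∇w|²) u² = e^{2v} |du + u d(v+w)|²_G + div_G B` with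
`B = −u² e^{2v} ∇(v + w)` (`div(ψ Z) = ψ div Z + dψ(Z)`, `div ∇φ = Δφ`).
[cite: ChruscielDelay2003, App. C, Prop. C.2] -/
theorem IsMetricOn.weightedPoincare_pointwise (hG : IsMetricOn G V) (hx : x ∈ V)
    (hu : ContDiffOn ℝ ∞ u V) (hv : ContDiffOn ℝ ∞ v V) (hw : ContDiffOn ℝ ∞ w V) :
    Real.exp (2 * v x) * gradSqAt G u x
      - Real.exp (2 * v x) * (lapAt G v x + lapAt G w x + gradSqAt G v x - gradSqAt G w x)
        * u x ^ 2 =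
      Real.exp (2 * v x) * (fderiv ℝ u x + u x • fderiv ℝ (fun y ↦ v y + w y) x)
          (sharpAt G x (fderiv ℝ u x + u x • fderiv ℝ (fun y ↦ v y + w y) x))
        + divAt G (fun y ↦ (-(u y ^ 2 * Real.exp (2 * v y))) •
            sharpAt G y (fderiv ℝ (fun z ↦ v z + w z) y)) x := by
  have hi := hG.isInvertible x hx
  have hs := hG.symm x hx
  have hxs : V ∈ 𝓝 x := hG.mem_nhds hx
  have hφ : ContDiffOn ℝ ∞ (fun y ↦ v y + w y) V := hv.add hw
  -- differentiability at `x`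
  have hud : DifferentiableAt ℝ u x := ((hu x hx).contDiffAt hxs).differentiableAt (by simp)
  have hvd : DifferentiableAt ℝ v x := ((hv x hx).contDiffAt hxs).differentiableAt (by simp)
  have hwd : DifferentiableAt ℝ w x := ((hw x hx).contDiffAt hxs).differentiableAt (by simp)
  have hv2 : ContDiffAt ℝ 2 v x := contDiffAt_two_of_contDiffOn hG.isOpen hv hx
  have hw2 : ContDiffAt ℝ 2 w x := contDiffAt_two_of_contDiffOn hG.isOpen hw hx
  have hZs : ContDiffOn ℝ ∞ (fun y ↦ sharpAt G y (fderiv ℝ (fun z ↦ v z + w z) y)) V :=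
    hG.contDiffOn_sharpAt.clm_apply (hφ.fderiv_of_isOpen hG.isOpen (by simp))
  have hZd : DifferentiableAt ℝ (fun y ↦ sharpAt G y (fderiv ℝ (fun z ↦ v z + w z) y)) x :=
    ((hZs x hx).contDiffAt hxs).differentiableAt (by simp)
  -- the weight `ψ = −u² e^{2v}` and its differential
  have hψ : HasFDerivAt (fun y ↦ -(u y ^ 2 * Real.exp (2 * v y)))
      (-((u x ^ 2) • (Real.exp (2 * v x) • ((2 : ℝ) • fderiv ℝ v x))
        + Real.exp (2 * v x) • ((2 * u x) • fderiv ℝ u x))) x := by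
    have h1 : HasFDerivAt (fun y ↦ u y ^ 2) ((2 * u x) • fderiv ℝ u x) x := by
      have h := hud.hasFDerivAt.pow 2
      simp only [Nat.add_one_sub_one, pow_one, nsmul_eq_mul, Nat.cast_ofNat] at h
      exact h
    have h2 : HasFDerivAt (fun y ↦ Real.exp (2 * v y))
        (Real.exp (2 * v x) • ((2 : ℝ) • fderiv ℝ v x)) x :=
      (hvd.hasFDerivAt.const_mul (2 : ℝ)).exp
    exact (h1.mul h2).neg
  have hψd : DifferentiableAt ℝ (fun y ↦ -(u y ^ 2 * Real.exp (2 * v y))) x :=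
    hψ.differentiableAt
  -- the divergence of `B = ψ • ♯d(v+w)`
  rw [divAt_smul hψd hZd, hG.divAt_sharpAt_fderiv hx hφ, lapAt_add G hv2 hw2, hψ.fderiv,
    fderiv_fun_add hvd hwd]
  -- abbreviations for the pairings of the differentials
  set du := fderiv ℝ u x with hdu
  set dv := fderiv ℝ v x with hdv
  set dw := fderiv ℝ w x with hdw
  have epv : du (sharpAt G x dv) = dv (sharpAt G x du) := apply_sharpAt_comm' hi hs du dv
  have epw : du (sharpAt G x dw) = dw (sharpAt G x du) := apply_sharpAt_comm' hi hs du dw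
  have evw : dv (sharpAt G x dw) = dw (sharpAt G x dv) := apply_sharpAt_comm' hi hs dv dw
  simp only [gradSqAt_apply, map_add, map_smul, _root_.add_apply, FunLike.coe_smul,
    Pi.smul_apply, _root_.neg_apply, smul_eq_mul, ← hdu, ← hdv, ← hdw]
  rw [epv, epw, evw]
  ring

/-! ### Continuity and support bookkeeping -/

omit [NormedSpace ℝ E] [FiniteDimensional ℝ E] [CompleteSpace E] [Fintype ι] [DecidableEq ι] in
/-- A function continuous at the points of `V` and locally zero off a compact subset of `V`
is continuous with compact support. [folklore] -/
private theorem continuous_and_hasCompactSupport_of {k : E → ℝ} {S : Set E} (hSV : S ⊆ V)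
    (hS : IsCompact S) (hk : ∀ y ∈ V, ContinuousAt k y) (hk0 : ∀ y ∉ S, k =ᶠ[𝓝 y] fun _ ↦ 0) :
    Continuous k ∧ HasCompactSupport k := by
  refine ⟨continuous_iff_continuousAt.2 fun y ↦ ?_, ?_⟩
  · by_cases hy : y ∈ S
    · exact hk y (hSV hy)
    · exact (continuousAt_const.congr_of_eventuallyEq (hk0 y hy) :)
  · refine HasCompactSupport.of_support_subset_isCompact hS fun y hy ↦ ?_
    by_contra hyS
    exact hy (hk0 y hyS).self_of_nhds

/-! ### Prop. C.2: the weighted Poincaré inequality -/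

section Integral

variable [MeasurableSpace E] [BorelSpace E] (μ : Measure E) [μ.IsAddHaarMeasure]

/-- **Weighted Poincaré inequality** (Chruściel–Delay 2003, App. C, Prop. C.2, scalar case): for
Riemannian metric components `G` on `V`, `u` smooth on `V` with compact support inside `V` and
`v, w` smooth on `V`,
`∫ √det g · e^{2v} (Δv + Δw + |∇v|² − |∇w|²) u² dμ ≤ ∫ √det g · e^{2v} |∇u|² dμ`.
Proof as printed: `0 ≤ ∫ e^{2v} |∇u + u∇(v+w)|²` and an integration by parts
(`weightedPoincare_pointwise`, `IsMetricOn.integral_sqrtDetGram_mul_eq_of_eq_add_divAt`).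
[cite: ChruscielDelay2003, App. C, Prop. C.2] -/
theorem IsMetricOn.integral_weightedPoincare (hG : IsMetricOn G V)
    (hpos : ∀ y ∈ V, ∀ e : E, e ≠ 0 → 0 < G y e e)
    (hu : ContDiffOn ℝ ∞ u V) (hsupp : HasCompactSupport u) (huV : tsupport u ⊆ V)
    (hv : ContDiffOn ℝ ∞ v V) (hw : ContDiffOn ℝ ∞ w V) :
    ∫ y, sqrtDetGram G b y * (Real.exp (2 * v y)
        * (lapAt G v y + lapAt G w y + gradSqAt G v y - gradSqAt G w y) * u y ^ 2) ∂μ ≤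
      ∫ y, sqrtDetGram G b y * (Real.exp (2 * v y) * gradSqAt G u y) ∂μ := by
  -- notation
  set φ : E → ℝ := fun y ↦ v y + w y with hφdef
  have hφ : ContDiffOn ℝ ∞ φ V := hv.add hw
  set α : E → E →L[ℝ] ℝ := fun y ↦ fderiv ℝ u y + u y • fderiv ℝ φ y with hαdef
  set h : E → ℝ := fun y ↦ Real.exp (2 * v y) * α y (sharpAt G y (α y)) with hhdef
  set f₁ : E → ℝ := fun y ↦ Real.exp (2 * v y) * gradSqAt G u y with hf₁
  set f₂ : E → ℝ := fun y ↦ Real.exp (2 * v y)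
      * (lapAt G v y + lapAt G w y + gradSqAt G v y - gradSqAt G w y) * u y ^ 2 with hf₂
  set B : E → E := fun y ↦ (-(u y ^ 2 * Real.exp (2 * v y))) •
      sharpAt G y (fderiv ℝ φ y) with hBdef
  -- `u` vanishes to first order off its support, and off `V`
  have hu0 : ∀ y ∉ tsupport u, ∀ᶠ z in 𝓝 y, u z = 0 ∧ fderiv ℝ u z = 0 := by
    intro y hy
    have hyu : u =ᶠ[𝓝 y] fun _ ↦ 0 := notMem_tsupport_iff_eventuallyEq.mp hy
    obtain ⟨U, hU, hUo, hyU⟩ := mem_nhds_iff.1 hyu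
    filter_upwards [hUo.mem_nhds hyU] with z hz
    have hzu : u =ᶠ[𝓝 z] fun _ ↦ 0 :=
      Filter.eventually_of_mem (hUo.mem_nhds hz) fun t ht ↦ hU ht
    exact ⟨hzu.self_of_nhds, by rw [hzu.fderiv_eq, fderiv_fun_const]; rfl⟩
  have hgrad0 : ∀ z, fderiv ℝ u z = 0 → gradSqAt G u z = 0 := fun z hz ↦ by
    rw [gradSqAt_apply, hz, _root_.zero_apply]
  have hα0 : ∀ z, u z = 0 → fderiv ℝ u z = 0 → α z = 0 := fun z h0 h1 ↦ by
    simp only [hαdef, h0, h1, zero_smul, add_zero]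
  -- smoothness on `V`
  have hBs : ContDiffOn ℝ ∞ B V :=
    ((hu.pow 2).mul (contDiffOn_const.mul hv).exp).neg.smul
      (hG.contDiffOn_sharpAt.clm_apply (hφ.fderiv_of_isOpen hG.isOpen (by simp)))
  have hBsupp : HasCompactSupport B := by
    refine hsupp.mono' fun y hy ↦ ?_
    by_contra hyu
    exact hy (by simp [hBdef, (hu0 y hyu).self_of_nhds.1])
  have hBV : tsupport B ⊆ V := by
    refine (closure_minimal (fun y hy ↦ ?_) (isClosed_tsupport u)).trans huV
    by_contra hyu
    exact hy (by simp [hBdef, (hu0 y hyu).self_of_nhds.1])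
  have hαs : ContDiffOn ℝ ∞ α V :=
    (hu.fderiv_of_isOpen hG.isOpen (by simp)).add (hu.smul (hφ.fderiv_of_isOpen hG.isOpen (by simp)))
  have hhs : ContDiffOn ℝ ∞ h V :=
    (contDiffOn_const.mul hv).exp.mul (hαs.clm_apply (hG.contDiffOn_sharpAt.clm_apply hαs))
  have hf₁s : ContDiffOn ℝ ∞ f₁ V := (contDiffOn_const.mul hv).exp.mul (hG.contDiffOn_gradSqAt hu)
  have hf₂s : ContDiffOn ℝ ∞ f₂ V :=
    (((contDiffOn_const.mul hv).exp.mul ((((hG.contDiffOn_lapAt hv).add (hG.contDiffOn_lapAt hw)).add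
      (hG.contDiffOn_gradSqAt hv)).sub (hG.contDiffOn_gradSqAt hw))).mul (hu.pow 2))
  have hsg : ContDiffOn ℝ ∞ (sqrtDetGram G b) V := hG.contDiffOn_sqrtDetGram b hpos
  have cont : ∀ {k : E → ℝ}, ContDiffOn ℝ ∞ k V → ∀ y ∈ V,
      ContinuousAt (fun z ↦ sqrtDetGram G b z * k z) y := fun hk y hy ↦
    ((hsg.continuousOn.continuousWithinAt hy).continuousAt (hG.mem_nhds hy)).mul
      ((hk.continuousOn.continuousWithinAt hy).continuousAt (hG.mem_nhds hy))
  -- integrability of the three integrands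
  have hI : ∀ {k : E → ℝ}, ContDiffOn ℝ ∞ k V →
      (∀ z, u z = 0 → fderiv ℝ u z = 0 → k z = 0) →
      Integrable (fun z ↦ sqrtDetGram G b z * k z) μ := by
    intro k hk hk0
    obtain ⟨hc, hcs⟩ := continuous_and_hasCompactSupport_of huV hsupp (cont hk) fun y hy ↦
      (hu0 y hy).mono fun z hz ↦ by simp only [hk0 z hz.1 hz.2, mul_zero]
    exact hc.integrable_of_hasCompactSupport hcs
  have hf₁0 : ∀ z, u z = 0 → fderiv ℝ u z = 0 → f₁ z = 0 := fun z h0 h1 ↦ by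
    simp only [hf₁, hgrad0 z h1, mul_zero]
  have hf₂0 : ∀ z, u z = 0 → fderiv ℝ u z = 0 → f₂ z = 0 := fun z h0 _ ↦ by
    simp only [hf₂, h0]; ring
  have hh0 : ∀ z, u z = 0 → fderiv ℝ u z = 0 → h z = 0 := fun z h0 h1 ↦ by
    simp only [hhdef, hα0 z h0 h1, _root_.zero_apply, mul_zero]
  have hI₁ := hI hf₁s hf₁0
  have hI₂ := hI hf₂s hf₂0
  have hIh := hI hhs hh0
  -- off `V` everything vanishes
  have hoff : ∀ y ∉ V, u y = 0 ∧ fderiv ℝ u y = 0 := fun y hy ↦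
    (hu0 y fun h' ↦ hy (huV h')).self_of_nhds
  -- the Green identity, integrated
  have hGreen : ∫ y, sqrtDetGram G b y * (f₁ y - f₂ y) ∂μ = ∫ y, sqrtDetGram G b y * h y ∂μ := by
    refine hG.integral_sqrtDetGram_mul_eq_of_eq_add_divAt b μ hpos hBs hBsupp hBV
      (fun y hy ↦ ?_) (fun y hy ↦ ?_) (fun y hy ↦ ?_) hIh
    · exact hG.weightedPoincare_pointwise hy hu hv hw
    · rw [hf₁0 y (hoff y hy).1 (hoff y hy).2, hf₂0 y (hoff y hy).1 (hoff y hy).2, sub_zero]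
    · exact hh0 y (hoff y hy).1 (hoff y hy).2
  -- positivity of the right-hand side
  have hpos' : 0 ≤ ∫ y, sqrtDetGram G b y * h y ∂μ := by
    refine integral_nonneg fun y ↦ ?_
    show 0 ≤ sqrtDetGram G b y * h y
    by_cases hy : y ∈ V
    · refine mul_nonneg (Real.sqrt_nonneg _) (mul_nonneg (Real.exp_nonneg _) ?_)
      have hi := hG.isInvertible y hy
      rw [← apply_sharpAt_apply hi (α y) (sharpAt G y (α y))]
      by_cases hz : sharpAt G y (α y) = 0
      · simp [hz]
      · exact (hpos y hy _ hz).le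
    · rw [hh0 y (hoff y hy).1 (hoff y hy).2, mul_zero]
  have hsplit : ∫ y, sqrtDetGram G b y * (f₁ y - f₂ y) ∂μ =
      (∫ y, sqrtDetGram G b y * f₁ y ∂μ) - ∫ y, sqrtDetGram G b y * f₂ y ∂μ := by
    simp_rw [mul_sub]
    exact integral_sub hI₁ hI₂
  have key : (∫ y, sqrtDetGram G b y * f₂ y ∂μ) ≤ ∫ y, sqrtDetGram G b y * f₁ y ∂μ := by
    linarith [hGreen, hsplit, hpos']
  simpa only [hf₁, hf₂] using key

/-- **Lemma C.1** (Chruściel–Delay 2003, App. C): for `u` smooth on `V` with compact support inside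
`V` and `w` smooth on `V`, `∫ √det g · (Δw − |∇w|²) u² dμ ≤ ∫ √det g · |∇u|² dμ`
(Prop. C.2 with `v = 0`). [cite: ChruscielDelay2003, App. C, Lemma C.1] -/
theorem IsMetricOn.integral_poincare_lemmaC1 (hG : IsMetricOn G V)
    (hpos : ∀ y ∈ V, ∀ e : E, e ≠ 0 → 0 < G y e e)
    (hu : ContDiffOn ℝ ∞ u V) (hsupp : HasCompactSupport u) (huV : tsupport u ⊆ V)
    (hw : ContDiffOn ℝ ∞ w V) :
    ∫ y, sqrtDetGram G b y * ((lapAt G w y - gradSqAt G w y) * u y ^ 2) ∂μ ≤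
      ∫ y, sqrtDetGram G b y * gradSqAt G u y ∂μ := by
  have h := hG.integral_weightedPoincare b μ hpos hu hsupp huV
    (contDiffOn_const (c := (0 : ℝ))) hw
  have h0 : ∀ y, gradSqAt G (fun _ : E ↦ (0 : ℝ)) y = 0 := fun y ↦ by
    rw [gradSqAt_apply, fderiv_fun_const]; rfl
  simpa only [mul_zero, Real.exp_zero, one_mul, lapAt_const, zero_add, h0, add_zero] using h

end Integral

end MetricCoord

end Literature.Geometry.Lorentzian

end
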